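import Mathlib
import HarnessLib
import Literature.Computability.AlgebraicComplexity.PatternExpressions
import Summits.ValiantsHypothesis.ValiantsHypothesis.Theorems.MonotoneRestorationOrbitCompressionQPPuncturedGadget

/-!
# Route MonotoneRestoration — aside `OrbitCompressionQP` (stmt-ValiantsHypothesis-18332), line
# `expression_compression`: the SECOND-ROW-AFFINE 2-row stratum, assembled in the stub's shape

`…PuncturedGadget.narrowQP_twoRow_affine` is stated on `(m+1) × (m+1)` matrices.  This file re-indexes it
into the literal shape of `stub_narrowExpressionCompression`'s conclusion (`∀ n ≥ 1`) and adds the one-row part,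
so that the whole second-row-affine inner polynomial is covered:

  `g(r, s) = g₀(r) + Σ_b s_b F(r_b; r_{-b})`,  `f_n = Σ_{i,i'} g(row i, row i') = n · Σ_i g₀(row i) + Σ_i Σ_b c_b F(x_{ib}; row i ∖ b)`

(`c_b` the column sum), for every symmetric `VQP` family `g₀` and every `VQP` family `F` symmetric in the
punctured row.

* `narrowQP_of_succ_indexed` — `(∀ m, P(m+1))`-shaped NQP statements give the stub's `∀ n ≥ 1` shape;
* ★ `narrowQP_twoRow_affine_std` — `narrowQP_twoRow_affine` in the stub's shape;
* ★★ `narrowQP_twoRow_secondRowAffine` — the full second-row-affine 2-row stratum (one-row part by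
  Bläser–Jindal `narrowQP_oneRow`, affine part by the punctured gadget, combined by `narrowQP_add`/`narrowQP_smul`).

Helper file (`--supports stmt-ValiantsHypothesis-18332`); def-free; nothing here is a named fact; no registered
stub is closed; VP ≠ VNP is not moved.
-/

noncomputable section

open MvPolynomial

-- `Summit.ValiantsHypothesis.ValiantsHypothesis.…` is the tree's single-conjunct layout (Sub = Summit).
set_option linter.dupNamespace false

namespace Summit.ValiantsHypothesis.ValiantsHypothesis.Theorems

namespace FormulaSubstitution

open Literature.Computability.AlgebraicComplexity

/-- Re-indexing: an NQP statement on `(m+1) × (m+1)` matrices for all `m` is the stub's `∀ n ≥ 1` statement.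
[folklore] -/
theorem narrowQP_of_succ_indexed (f : (n : ℕ) → MvPolynomial (Fin n × Fin n) ℂ)
    (h : ∃ c : ℕ, ∀ m : ℕ, ∃ (k l : ℕ) (e : PatternExpr ℂ k l),
      (m + 1) ^ (k + l) ≤ 2 ^ ((Nat.log 2 (m + 1) + c) ^ c) ∧
      e.length ≤ 2 ^ ((Nat.log 2 (m + 1) + c) ^ c) ∧ e.close (m + 1) = f (m + 1)) :
    ∃ c : ℕ, ∀ n : ℕ, 1 ≤ n → ∃ (k l : ℕ) (e : PatternExpr ℂ k l),
      n ^ (k + l) ≤ 2 ^ ((Nat.log 2 n + c) ^ c) ∧ e.length ≤ 2 ^ ((Nat.log 2 n + c) ^ c) ∧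
      e.close n = f n := by
  obtain ⟨c, hc⟩ := h
  refine ⟨c, fun n hn => ?_⟩
  obtain ⟨m, rfl⟩ : ∃ m, n = m + 1 := ⟨n - 1, by omega⟩
  exact hc m

/-- ★ **The second-row-affine 2-row stratum in the stub's shape**: for a `VQP` family `F_m ∈ ℂ[t, z_1..z_m]`
symmetric in `z` and any family `f` with `f_{m+1} = Σ_i Σ_b (Σ_{i'} x_{i'b}) · F_m(x_{ib}; row i ∖ b)`, `f`
satisfies the conclusion of `stub_narrowExpressionCompression`. [cite: BlaserJindal2019, Thm. 4] -/
theorem narrowQP_twoRow_affine_std (F : (m : ℕ) → MvPolynomial (Option (Fin m)) ℂ)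
    (hsymm : ∀ (m : ℕ) (τ : Equiv.Perm (Fin m)), rename (Option.map τ) (F m) = F m)
    (hF : IsVQPFamily F) (f : (n : ℕ) → MvPolynomial (Fin n × Fin n) ℂ)
    (hf : ∀ m : ℕ, f (m + 1) = ∑ i : Fin (m + 1), ∑ b : Fin (m + 1),
        (∑ i' : Fin (m + 1), (X (i', b) : MvPolynomial (Fin (m + 1) × Fin (m + 1)) ℂ)) *
        aeval (fun o : Option (Fin m) => o.elim (X (i, b))
          (fun j => (X (i, b.succAbove j) : MvPolynomial (Fin (m + 1) × Fin (m + 1)) ℂ))) (F m)) :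
    ∃ c : ℕ, ∀ n : ℕ, 1 ≤ n → ∃ (k l : ℕ) (e : PatternExpr ℂ k l),
      n ^ (k + l) ≤ 2 ^ ((Nat.log 2 n + c) ^ c) ∧ e.length ≤ 2 ^ ((Nat.log 2 n + c) ^ c) ∧
      e.close n = f n := by
  obtain ⟨c, hc⟩ := narrowQP_twoRow_affine F hsymm hF
  refine narrowQP_of_succ_indexed f ⟨c, fun m => ?_⟩
  obtain ⟨k, l, e, hkl, hlen, hclose⟩ := hc m
  exact ⟨k, l, e, hkl, hlen, by rw [hclose, hf]⟩

/-- ★★ **The full second-row-affine 2-row stratum.**  For a symmetric `VQP` family `g₀` (one-row part) and a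
`VQP` family `F` symmetric in the punctured row, every family `f` with
`f_{m+1} = (m+1) · Σ_i g₀(row i) + Σ_i Σ_b (Σ_{i'} x_{i'b}) · F_m(x_{ib}; row i ∖ b)`
— that is `f_n = Σ_{i,i'} g(row i, row i')` for `g(r, s) = g₀(r) + Σ_b s_b F(r_b; r_{-b})`, the general
second-row-affine column-symmetric inner polynomial — satisfies the conclusion of
`stub_narrowExpressionCompression`. [cite: BlaserJindal2019, Thm. 4] -/
theorem narrowQP_twoRow_secondRowAffine (g₀ : (n : ℕ) → MvPolynomial (Fin n) ℂ)
    (hg₀s : ∀ n, (g₀ n).IsSymmetric) (hg₀ : IsVQPFamily g₀)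
    (F : (m : ℕ) → MvPolynomial (Option (Fin m)) ℂ)
    (hFs : ∀ (m : ℕ) (τ : Equiv.Perm (Fin m)), rename (Option.map τ) (F m) = F m)
    (hF : IsVQPFamily F) (f : (n : ℕ) → MvPolynomial (Fin n × Fin n) ℂ)
    (hf : ∀ m : ℕ, f (m + 1) =
      ((m + 1 : ℕ) : ℂ) • (∑ i : Fin (m + 1),
        aeval (fun v : Fin (m + 1) => (X (i, v) : MvPolynomial (Fin (m + 1) × Fin (m + 1)) ℂ)) (g₀ (m + 1))) +
      ∑ i : Fin (m + 1), ∑ b : Fin (m + 1),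
        (∑ i' : Fin (m + 1), (X (i', b) : MvPolynomial (Fin (m + 1) × Fin (m + 1)) ℂ)) *
        aeval (fun o : Option (Fin m) => o.elim (X (i, b))
          (fun j => (X (i, b.succAbove j) : MvPolynomial (Fin (m + 1) × Fin (m + 1)) ℂ))) (F m)) :
    ∃ c : ℕ, ∀ n : ℕ, 1 ≤ n → ∃ (k l : ℕ) (e : PatternExpr ℂ k l),
      n ^ (k + l) ≤ 2 ^ ((Nat.log 2 n + c) ^ c) ∧ e.length ≤ 2 ^ ((Nat.log 2 n + c) ^ c) ∧
      e.close n = f n := by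
  classical
  -- the affine part as a family in the stub's indexing
  set fa : (n : ℕ) → MvPolynomial (Fin n × Fin n) ℂ := fun n =>
    match n with
    | 0 => 0
    | m + 1 => ∑ i : Fin (m + 1), ∑ b : Fin (m + 1),
        (∑ i' : Fin (m + 1), (X (i', b) : MvPolynomial (Fin (m + 1) × Fin (m + 1)) ℂ)) *
        aeval (fun o : Option (Fin m) => o.elim (X (i, b))
          (fun j => (X (i, b.succAbove j) : MvPolynomial (Fin (m + 1) × Fin (m + 1)) ℂ))) (F m)
    with hfa
  have ha := narrowQP_twoRow_affine_std F hFs hF fa (fun m => rfl)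
  have h1 := NarrowClosure.narrowQP_smul (fun n => ∑ i : Fin n,
      aeval (fun v : Fin n => (X (i, v) : MvPolynomial (Fin n × Fin n) ℂ)) (g₀ n))
    (fun n => ((n : ℕ) : ℂ)) (narrowQP_oneRow g₀ hg₀s hg₀)
  obtain ⟨c, hc⟩ := NarrowClosure.narrowQP_add _ _ h1 ha
  refine ⟨c, fun n hn => ?_⟩
  obtain ⟨k, l, e, hkl, hlen, hclose⟩ := hc n hn
  refine ⟨k, l, e, hkl, hlen, ?_⟩
  obtain ⟨m, rfl⟩ : ∃ m, n = m + 1 := ⟨n - 1, by omega⟩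
  rw [hclose, hf]

end FormulaSubstitution

end Summit.ValiantsHypothesis.ValiantsHypothesis.Theorems

end
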